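import Mathlib
import HarnessLib

/-!
# ValiantsHypothesis / LacunarySymmetroid — crux `MatrixDescartes` (stmt-ValiantsHypothesis-18050, V1),
# LINE (A) «product_plus_one», floor stub `OneChangeFloorK3`: the MOMENT CERTIFICATE behind the first interaction lemma

Memo `pub/val-lit/lmr/NOTE-p7g15-18050-LINEA-incoherent-cell.md` §9 (the one-riser lemma: a switched incoherent trinomial against any cloud of
binomial pullers has at most three Euler zeros on the component) rests on ONE analytic fact: with the puller moments
`S_k(y) = Σ_i m_i (z_i − y)^{−k}` (`m_i > 0`, `z_i > y`) the function `Ψ = S₁ + S₂/S₁` is increasing and LOG-CONVEX in `y`.  Since `S_k′ = k·S_{k+1}`,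
log-convexity is the polynomial inequality
  `X := (S₁² + S₂)(2S₁³S₃ + 6S₁²S₄ − 6S₁S₂S₃ + 2S₂³) − (S₁²S₂ + 2S₁S₃ − S₂²)² ≥ 0`   (`= S₁⁴·(ΨΨ″ − Ψ′²)`),
and this file proves it from the two Cauchy–Schwarz moment inequalities `S₂² ≤ S₁S₃`, `S₃² ≤ S₂S₄`:

* `moment_cauchySchwarz` — `(Σ m u^{k+1})² ≤ (Σ m u^k)(Σ m u^{k+2})` for nonnegative weights and values (Lagrange's identity:
  the difference is `½ Σ_i Σ_j m_i m_j u_i^k u_j^k (u_i − u_j)²`);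
* `psi_certificate_identity` — `X = S₁⁴(2S₁S₃ − S₂²) + 2S₁²(3S₁²S₄ − 4S₁S₂S₃ + 2S₂³) + (6S₁²S₂S₄ − 4S₁²S₃² − 2S₁S₂²S₃ + S₂⁴)` (ring);
* `psi_certificate_pos` — `0 < X` whenever `S₁ > 0`, `S₂ > 0`, `S₂² ≤ S₁S₃`, `S₃² ≤ S₂S₄` (first bracket `≥ S₂²`; second `≥ 0` by
  `S₂·(…) ≥ 3(S₁S₃)² − 4(S₁S₃)S₂² + 2S₂⁴ > 0`; third `≥ (S₁S₃)² + (S₁S₃ − S₂²)²`);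
* `psi_certificate_of_moments` — the same for actual moment sums `S_k = Σ_i m_i u_i^k` over a nonempty finset with `m_i, u_i > 0`.

Honest framing: an inequality; it bounds no zero count by itself (that is `…OneRiser`, next); NOT `OneChangeFloorK3` / `stub_classRowK3` /
`stub_polyLaw` / `MatrixDescartes` / B; `VP ≠ VNP` NOT proved.  No definitions, no named facts; Mathlib only.
-/

set_option linter.dupNamespace false

namespace Summit.ValiantsHypothesis.ValiantsHypothesis.Theorems.LacunarySymmetroidMatrixDescartes

namespace ProductPlusOne

open Finset
open scoped BigOperators

/-- **Cauchy–Schwarz for weighted power sums** (Lagrange's identity): `(Σ m u^{k+1})² ≤ (Σ m u^k)(Σ m u^{k+2})` for `m, u ≥ 0`. [folklore] -/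
theorem moment_cauchySchwarz {ι : Type*} (s : Finset ι) (m u : ι → ℝ) (hm : ∀ i ∈ s, 0 ≤ m i) (hu : ∀ i ∈ s, 0 ≤ u i) (k : ℕ) :
    (∑ i ∈ s, m i * u i ^ (k + 1)) ^ 2 ≤ (∑ i ∈ s, m i * u i ^ k) * (∑ i ∈ s, m i * u i ^ (k + 2)) := by
  -- Lagrange: 2·(RHS − LHS) = Σ_i Σ_j m_i m_j u_i^k u_j^k (u_i − u_j)²
  have hL : (∑ i ∈ s, m i * u i ^ k) * (∑ i ∈ s, m i * u i ^ (k + 2)) - (∑ i ∈ s, m i * u i ^ (k + 1)) ^ 2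
      = ∑ i ∈ s, ∑ j ∈ s, m i * m j * (u i ^ k * u j ^ k) * (u j ^ 2 - u i * u j) := by
    rw [sq, Finset.sum_mul_sum, Finset.sum_mul_sum, ← Finset.sum_sub_distrib]
    refine Finset.sum_congr rfl fun i _ => ?_
    rw [← Finset.sum_sub_distrib]
    refine Finset.sum_congr rfl fun j _ => by ring
  have hsymm : ∑ i ∈ s, ∑ j ∈ s, m i * m j * (u i ^ k * u j ^ k) * (u j ^ 2 - u i * u j)
      = ∑ i ∈ s, ∑ j ∈ s, m i * m j * (u i ^ k * u j ^ k) * (u i ^ 2 - u j * u i) := by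
    rw [Finset.sum_comm]
    refine Finset.sum_congr rfl fun i _ => Finset.sum_congr rfl fun j _ => by ring
  have h2 : 2 * ((∑ i ∈ s, m i * u i ^ k) * (∑ i ∈ s, m i * u i ^ (k + 2)) - (∑ i ∈ s, m i * u i ^ (k + 1)) ^ 2)
      = ∑ i ∈ s, ∑ j ∈ s, m i * m j * (u i ^ k * u j ^ k) * (u i - u j) ^ 2 := by
    rw [two_mul]
    conv_lhs => rw [hL]; arg 2; rw [hsymm]
    rw [← Finset.sum_add_distrib]
    refine Finset.sum_congr rfl fun i _ => ?_
    rw [← Finset.sum_add_distrib]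
    refine Finset.sum_congr rfl fun j _ => by ring
  have hnn : 0 ≤ ∑ i ∈ s, ∑ j ∈ s, m i * m j * (u i ^ k * u j ^ k) * (u i - u j) ^ 2 :=
    Finset.sum_nonneg fun i hi => Finset.sum_nonneg fun j hj =>
      mul_nonneg (mul_nonneg (mul_nonneg (hm i hi) (hm j hj)) (mul_nonneg (pow_nonneg (hu i hi) _) (pow_nonneg (hu j hj) _)))
        (sq_nonneg _)
  rw [← h2] at hnn
  linarith

/-- **The certificate identity** `X = S₁⁴(2S₁S₃ − S₂²) + 2S₁²(3S₁²S₄ − 4S₁S₂S₃ + 2S₂³) + (6S₁²S₂S₄ − 4S₁²S₃² − 2S₁S₂²S₃ + S₂⁴)`. [this file's lemma] -/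
theorem psi_certificate_identity (S₁ S₂ S₃ S₄ : ℝ) :
    (S₁ ^ 2 + S₂) * (2 * S₁ ^ 3 * S₃ + 6 * S₁ ^ 2 * S₄ - 6 * S₁ * S₂ * S₃ + 2 * S₂ ^ 3) - (S₁ ^ 2 * S₂ + 2 * S₁ * S₃ - S₂ ^ 2) ^ 2
      = S₁ ^ 4 * (2 * S₁ * S₃ - S₂ ^ 2) + 2 * S₁ ^ 2 * (3 * S₁ ^ 2 * S₄ - 4 * S₁ * S₂ * S₃ + 2 * S₂ ^ 3)
        + (6 * S₁ ^ 2 * S₂ * S₄ - 4 * S₁ ^ 2 * S₃ ^ 2 - 2 * S₁ * S₂ ^ 2 * S₃ + S₂ ^ 4) := by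
  ring

/-- ★ **The certificate is positive** under the two Cauchy–Schwarz moment inequalities. [this file's theorem] -/
theorem psi_certificate_pos (S₁ S₂ S₃ S₄ : ℝ) (h1 : 0 < S₁) (h2 : 0 < S₂)
    (h13 : S₂ ^ 2 ≤ S₁ * S₃) (h24 : S₃ ^ 2 ≤ S₂ * S₄) :
    0 < (S₁ ^ 2 + S₂) * (2 * S₁ ^ 3 * S₃ + 6 * S₁ ^ 2 * S₄ - 6 * S₁ * S₂ * S₃ + 2 * S₂ ^ 3)
      - (S₁ ^ 2 * S₂ + 2 * S₁ * S₃ - S₂ ^ 2) ^ 2 := by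
  rw [psi_certificate_identity]
  -- first bracket
  have hA : S₂ ^ 2 ≤ 2 * S₁ * S₃ - S₂ ^ 2 := by linarith
  have hA' : 0 < S₁ ^ 4 * (2 * S₁ * S₃ - S₂ ^ 2) := mul_pos (by positivity) (by nlinarith)
  -- second bracket: `S₂ · B ≥ 3t² − 4 t S₂² + 2 S₂⁴ > 0` with `t = S₁ S₃`
  have hB : 0 ≤ 3 * S₁ ^ 2 * S₄ - 4 * S₁ * S₂ * S₃ + 2 * S₂ ^ 3 := by
    have h1' : 0 ≤ 3 * S₁ ^ 2 := by positivity
    have hS24 : 3 * S₁ ^ 2 * S₃ ^ 2 ≤ 3 * S₁ ^ 2 * (S₂ * S₄) := mul_le_mul_of_nonneg_left h24 h1'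
    have hq : 0 ≤ 3 * (S₁ * S₃) ^ 2 - 4 * (S₁ * S₃) * S₂ ^ 2 + 2 * S₂ ^ 4 := by
      nlinarith [sq_nonneg (3 * (S₁ * S₃) - 2 * S₂ ^ 2), sq_nonneg (S₂ ^ 2)]
    have hprod : 0 ≤ S₂ * (3 * S₁ ^ 2 * S₄ - 4 * S₁ * S₂ * S₃ + 2 * S₂ ^ 3) := by nlinarith
    by_contra hneg
    push Not at hneg
    have := mul_neg_of_pos_of_neg h2 hneg
    linarith
  have hB' : 0 ≤ 2 * S₁ ^ 2 * (3 * S₁ ^ 2 * S₄ - 4 * S₁ * S₂ * S₃ + 2 * S₂ ^ 3) := mul_nonneg (by positivity) hB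
  -- third bracket: `≥ (S₁S₃)² + (S₁S₃ − S₂²)²`
  have hC : 0 ≤ 6 * S₁ ^ 2 * S₂ * S₄ - 4 * S₁ ^ 2 * S₃ ^ 2 - 2 * S₁ * S₂ ^ 2 * S₃ + S₂ ^ 4 := by
    have h1' : 0 ≤ 6 * S₁ ^ 2 := by positivity
    have hS24 : 6 * S₁ ^ 2 * S₃ ^ 2 ≤ 6 * S₁ ^ 2 * (S₂ * S₄) := mul_le_mul_of_nonneg_left h24 h1'
    nlinarith [sq_nonneg (S₁ * S₃), sq_nonneg (S₁ * S₃ - S₂ ^ 2)]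
  linarith

/-- ★ **Log-convexity certificate for actual moments**: `S_k = Σ_{i∈s} m_i u_i^k` over a nonempty finset with `m_i, u_i > 0`.
[this file's theorem] -/
theorem psi_certificate_of_moments {ι : Type*} (s : Finset ι) (hs : s.Nonempty) (m u : ι → ℝ)
    (hm : ∀ i ∈ s, 0 < m i) (hu : ∀ i ∈ s, 0 < u i) :
    0 < ((∑ i ∈ s, m i * u i) ^ 2 + ∑ i ∈ s, m i * u i ^ 2)
        * (2 * (∑ i ∈ s, m i * u i) ^ 3 * (∑ i ∈ s, m i * u i ^ 3) + 6 * (∑ i ∈ s, m i * u i) ^ 2 * (∑ i ∈ s, m i * u i ^ 4)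
          - 6 * (∑ i ∈ s, m i * u i) * (∑ i ∈ s, m i * u i ^ 2) * (∑ i ∈ s, m i * u i ^ 3) + 2 * (∑ i ∈ s, m i * u i ^ 2) ^ 3)
      - ((∑ i ∈ s, m i * u i) ^ 2 * (∑ i ∈ s, m i * u i ^ 2) + 2 * (∑ i ∈ s, m i * u i) * (∑ i ∈ s, m i * u i ^ 3)
          - (∑ i ∈ s, m i * u i ^ 2) ^ 2) ^ 2 := by
  have hm' : ∀ i ∈ s, 0 ≤ m i := fun i hi => (hm i hi).le
  have hu' : ∀ i ∈ s, 0 ≤ u i := fun i hi => (hu i hi).le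
  have e1 : (∑ i ∈ s, m i * u i) = ∑ i ∈ s, m i * u i ^ 1 := Finset.sum_congr rfl fun i _ => by ring
  have hpos : ∀ k : ℕ, 0 < ∑ i ∈ s, m i * u i ^ k := fun k =>
    Finset.sum_pos (fun i hi => mul_pos (hm i hi) (pow_pos (hu i hi) k)) hs
  have h13 := moment_cauchySchwarz s m u hm' hu' 1
  have h24 := moment_cauchySchwarz s m u hm' hu' 2
  rw [e1]
  exact psi_certificate_pos _ _ _ _ (hpos 1) (hpos 2) (by simpa using h13) (by simpa using h24)

end ProductPlusOne

end Summit.ValiantsHypothesis.ValiantsHypothesis.Theorems.LacunarySymmetroidMatrixDescartes
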